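import Summits.QuantumAdvantage.QuantumAdvantage.Theorems.NonDisperseEndA

set_option linter.dupNamespace false
set_option linter.unusedSectionVars false

/-!
# StructuredEndA (lens 4, g29; the STRUCTURED branch of kernel Y ((P2)/(P5)) ⟹ loss, via the low-rank pool end)

Blocker `X = AbsorptionDial.NoPerfectPolyOdd` (item 28487); decomp-qadv lens 4, g29.

When kernel Y's greedy dichotomy (`JointFreenessLawA.free_dichotomy`, `t = 1`, pencil member `Q = M + Mᵀ`) returns the STRUCTURED alternative, every
row `Q_j` of a direction class is `θ₀⁻¹·(Σ_{i ∈ I} c_j i Q_i + Σ_q c'_j q Λ_q + s_j)` with `|I| = r₁ < r` and light parts `s_j`; on a PAIR-FREE sub-pool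
`T` of that class (`s_a (T b) = 0` for `a ≠ b`, supplied by `JointFreenessLawC.exists_pairFree`) the symmetrised pool matrix is `A * B` with inner
dimension `r₁ + k` off the diagonal — EXACTLY the hypothesis `hR` (with `Z = ∅`) of `NonDisperseEndA.loss_of_lowRankPool`.

* `lowRank_of_structuredRows` — the factorisation `Q (T a) (T b) = (A * B) a b` (`a ≠ b`), pure algebra over a field;
* ★ `loss_of_structuredPool` — registers `g ≠ g₀` `k`-forms, `g₀ = H(labels, quadVal M b)`, structured rows + pair-free pool ⟹ loss on the subcube
  `fill ρ T ·` once `(n+1)·2p^(k + 2(r₁+k) + 1)·(2p−1)^f < (2p)^f`.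

(The tree's `JointFreenessLawB.pencil_factor` is the same normal form for a pencil of any size `t`; here `t = 1` is routed through the form table.)
Supports stmt-QuantumAdvantage-28487 (record; the residual `X` is NOT claimed).
-/

open Finset Module
open Summit.QuantumAdvantage.AdviceFreeQNC0
open Summit.QuantumAdvantage.QuantumAdvantage.Theorems.InnerDegreeDial

namespace Summit.QuantumAdvantage.QuantumAdvantage.Theorems.ColumnBridge

/-- **structured rows on a pair-free pool factor**: `Q (T a) (T b) = (A * B) a b` for `a ≠ b`, inner dimension `r₁ + k`. -/
theorem lowRank_of_structuredRows {F : Type*} [Field F] {n k f r₁ : ℕ} (Q : Fin n → Fin n → F) (Λ : Fin k → Fin n → F)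
    (eI : Fin r₁ → Fin n) (c : Fin f → Fin r₁ → F) (c' : Fin f → Fin k → F) (s : Fin f → Fin n → F) (θ₀ : F) (hθ : θ₀ ≠ 0)
    (T : Fin f ↪ Fin n)
    (hrow : ∀ a b, θ₀ * Q (T a) (T b) = (∑ x, c a x * Q (eI x) (T b)) + (∑ q, c' a q * Λ q (T b)) + s a (T b))
    (hpair : ∀ a b, a ≠ b → s a (T b) = 0) :
    ∃ (A : Matrix (Fin f) (Fin (r₁ + k)) F) (B : Matrix (Fin (r₁ + k)) (Fin f) F), ∀ a b, a ≠ b → Q (T a) (T b) = (A * B) a b := by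
  classical
  refine ⟨fun a => Fin.append (fun x => θ₀⁻¹ * c a x) (fun q => θ₀⁻¹ * c' a q),
    Fin.append (fun x b => Q (eI x) (T b)) (fun q b => Λ q (T b)), fun a b hab => ?_⟩
  rw [Matrix.mul_apply, Fin.sum_univ_add]
  simp only [Fin.append_left, Fin.append_right]
  have h := hrow a b
  rw [hpair a b hab, add_zero] at h
  have hQ : Q (T a) (T b) = θ₀⁻¹ * ((∑ x, c a x * Q (eI x) (T b)) + ∑ q, c' a q * Λ q (T b)) := by
    rw [← h, ← mul_assoc, inv_mul_cancel₀ hθ, one_mul]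
  rw [hQ, mul_add, mul_sum, mul_sum]
  congr 1
  · exact sum_congr rfl fun x _ => by ring
  · exact sum_congr rfl fun q _ => by ring

variable {p : ℕ} [Fact p.Prime] {n : ℕ}

/-- **LOSS ON A STRUCTURED PAIR-FREE POOL (the structured branch of kernel Y, kernel).**  Registers `g ≠ g₀` are `k`-forms,
`g₀ = H(labels, quadVal M b)`; the rows of `Q = M + Mᵀ` at the pool `T` are structured over `r₁` rows `eI` and the labels with light parts
`s_a` that are pair-free on the pool ⟹ loss on the subcube `fill ρ T ·`. -/
theorem loss_of_structuredPool (hp5 : 5 ≤ p) {k r₁ f : ℕ} (c₀ : ℕ)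
    (y : Fin (n + 1) → (Fin n → Bool) → Bool) (g₀ : Fin (n + 1))
    (lam : Fin (n + 1) → Fin k → Fin n → ZMod p) (F : Fin (n + 1) → (Fin k → ZMod p) → Bool)
    (hF : ∀ g, g ≠ g₀ → ∀ u, y g u = F g (fun j => ∑ i, if u i = true then lam g j i else 0))
    (Λ : Fin k → Fin n → ZMod p) (M : Fin n → Fin n → ZMod p) (b : Fin n → ZMod p)
    (H : (Fin k → ZMod p) → ZMod p → Bool)
    (hy₀ : ∀ u, y g₀ u = H (fun j => ∑ i, if u i = true then Λ j i else 0) (quadVal M b u))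
    (ρ : Fin n → Bool) (T : Fin f ↪ Fin n)
    (eI : Fin r₁ → Fin n) (c : Fin f → Fin r₁ → ZMod p) (c' : Fin f → Fin k → ZMod p) (s : Fin f → Fin n → ZMod p)
    (θ₀ : ZMod p) (hθ : θ₀ ≠ 0)
    (hrow : ∀ a b, θ₀ * (M (T a) (T b) + M (T b) (T a))
      = (∑ x, c a x * (M (eI x) (T b) + M (T b) (eI x))) + (∑ q, c' a q * Λ q (T b)) + s a (T b))
    (hpair : ∀ a b, a ≠ b → s a (T b) = 0)
    (hcount : (n + 1) * (p ^ (k + (2 * (r₁ + k) + 1)) * 2) * (2 * p - 1) ^ f < (2 * p) ^ f) :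
    ∃ v, ringWinU c₀ y (fill ρ T v) = false := by
  classical
  obtain ⟨A, B, hAB⟩ := lowRank_of_structuredRows (fun i l => M i l + M l i) Λ eI c c' s θ₀ hθ T hrow hpair
  refine loss_of_lowRankPool hp5 c₀ y g₀ lam F hF Λ M b H hy₀ ρ T ∅ A B (fun i j hij _ _ => hAB i j hij) ?_
  simpa only [card_empty, mul_zero, add_zero] using hcount

end Summit.QuantumAdvantage.QuantumAdvantage.Theorems.ColumnBridge
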